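import Literature.NumberTheory.GelbartRogawski1991.CMThetaTypeVocabulary
import Literature.NumberTheory.Rogawski1990.XiLocalCharacter
import Literature.RepresentationTheory.CharacterIsotypicSubspace
import HarnessLib

/-!
# [GelbartRogawski1991 §3.2, §5.2; GelbartRogawski1990 Prop. 5.2.2] The VOCABULARY of the local theta dichotomy at a
# non-split place — the rank-one Weil representation `ω¹` of `U(1) × U(1)` attached to a line, «`ν` occurs in `ω¹`»,
# the `U(1)`-character `ψθ` of the theta datum, the Witt kernel line of `diag dV`, and `X_v(μ, ε, χ_f)` read on `U(Φ₃)(L⁺_v)`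

Topic `NumberTheory/GelbartRogawski1991`; namespace `Literature.NumberTheory.GelbartRogawski1991` (the ★ CM theta-type
vocabulary `CMThetaTypeVocabulary`: `chiLocalSplittingsCM`, `xThetaCM`, `ThetaTypeAtCM`).  DEFINITIONS WITH BODIES ONLY (three data
abbreviations, one data `def`, two `Prop`-valued predicates) + two proved sanity lemmas; **no named fact, no theorem beyond the two
lemmas, no `sorry`, no instance, no notation; net debt 0**.  Cell `hodgecm-mathlib` (D-0151), programme P2 ∕ director g16 topic T7
«GR91 §5 local theta dichotomy for the true packet `{πⁿ(ξ_v), πˢ(ξ_v)}` (D7α local half, U′-N's sibling)», seat typ-T7a (2026-08-31).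
HONEST LABEL: HC_CM is proved only modulo the printed citations until rung 0 closes; this file proves nothing and introduces no debt.

THE MATHEMATICS.  At a place `v` of `L⁺` that does not split in the CM field `L` (`E_v := L ⊗ L⁺_v` a field), Gelbart–Rogawski's
characterisation of the local A-packet `Π(ξ_v) = {πⁿ(ξ_v), πˢ(ξ_v)}` as the set of the two local Weil representations
`{ω(γ_v, ψ_v, χ_v) : ψ_v mod N(E_vˣ)}` [GelbartRogawski1991, Lemma 5.1.2 p. 466] rests on ONE local mechanism, printed in the
proof of [GelbartRogawski1991, Prop. 5.2.1, p. 467 lines 25–27]: «recall from [GR₁, Prop. 5.2.2], that `ω³(γ_v, ψ_v, χ_v)` is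
supercuspidal if and only if `χ_v(γ_v¹)⁻¹` does not occur in `ω¹(γ_v, ψ_v)`» ([GR₁] = [GelbartRogawski1990], the PS-Festschrift
paper, not held — acq-10743; `ω¹(γ, ψ)`, `ω³(γ, ψ)` are «the corresponding oscillator representations» of `U(1)` and `U(3)` fixed
by «the choice of data `(γ, ψ)`», p. 467 lines 8–11), together with GR91's Remark p. 466: Lemma 5.1.2 «itself reduces to a
statement about the Howe correspondence pair `(U(1), U(1))` in the local case, namely, that for given `γ` and `χ`, there exists a
unique class of `ψ` such that `χ` occurs in `ω¹(γ, ψ)`» — the `(U(1), U(1))` theta dichotomy, ★ PROVED in the tree as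
`MoeglinVignerasWaldspurger1987.rankOne_theta_dichotomy`.  The mechanism behind Prop. 5.2.2 is the Jacquet module of the Weil
representation along the Borel `B = MN` of `U(3)` in the mixed model [GelbartRogawski1991, §3.2 (3.2.1)–(3.2.3) p. 457; «These
formulas follow from their local counterparts, discussed in [GR₁, §2]»]: `ω³_N ≅ ℱ` (the fibre at `w = 0`), on which
`d(α, β, ᾱ⁻¹) ∈ M` acts by `γ(α)‖α‖^{1/2} · ω¹(γ, ψ)(β)` — Kudla's filtration [Kudla1986, Thm. 2.8] has ONE piece because the line
`W₁` is anisotropic.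

WHAT IS NAMED HERE (all in the currency of ★ `CMThetaTypeVocabulary`: the CM field `L`, a conjugate-symplectic `μ` (Kudla's
splitting character = GR's `γ`), a character `χ_f` of `U(1)(𝔸_{L⁺,f})`, a line class `ε ∈ (L⁺)ˣ` (= GR's class of `ψ` modulo
norms, [Liu2021 l. 5217 footnote]), a finite place `v`):
* `IsThetaCenterChar L μ χf ε v ψθ` — «`ψθ` is the `U(1)`-character of the theta datum read on `E¹_v`»: for every `u ∈ U((ε))(L⁺_v)`,
  `ψθ(det u) = χ_{f,v}(u) · μ_v(det u)⁻¹`.  This is GR's `χ_v(γ_v¹)⁻¹` (their `χ_v` = the central character = our `χ_{f,v}`, their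
  `γ_v¹ = γ_v|_{E¹}` = our `μ_v|_{E¹_v}`).  TOKEN-IDENTICAL to the body of the Summits-side `CenterCharSpec` of the registered pay-down
  line `Cruxes/H413/Lines/F0_P2GR91NJacquet.lean` (:63), which `Literature/` cannot import — the Summits bridge is `Iff.rfl`.
* `kernelLineCM dV : Fin 1 → L`, `i ↦ −(dV 0 · dV 1 · dV 2)` — the WITT KERNEL LINE of `V = diag dV`: at every non-split `v` a rank-3
  hermitian space is `H ⊕ L₀` with `disc L₀ = −disc V` modulo norms (`disc H = −1`), [Jacobowitz1962, Thm. 3.1]; so `U(L₀)(L⁺_v) = E¹_v`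
  is the anisotropic factor of the Levi `M ≅ E_vˣ × U(L₀)` of `U(V)(L⁺_v)`; with `complexConj_kernelLineCM`, `kernelLineCM_ne_zero`.
* `lineSplittingsCM L e₀ dL hdL hdL0 θ hθ ε` — Kudla's `θ`-normalised CM package of local splittings for the RANK-(1,1) pair
  `U(diag dL) × U((ε))` inside `U(diag dL ⊗ (ε))`: the body of ★ `chiLocalSplittingsCM` with `(Fin 3, dV) ↦ (Fin 1, dL)` (the
  generic ★ `GRConstruction.congrW ∘ undoubledSplittings ∘ cmFinLocalFamily` at `N = M = 1`) [GelbartRogawski1991 §3.1 Prop. 3.1.1].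
* `lineWeilCM L e₀ dL hdL hdL0 μ hμ ε v` — **`ω¹`**: the local Weil representation of that rank-(1,1) package at `v` read on
  `U((ε))(L⁺_v) = E¹_v` through ★ `localCenter` (for a line the `U((ε))`-member IS the whole group `U(dL·ε)(L⁺_v) = E¹_v`); GR's
  `ω¹(γ_v, ψ_v)` with `(γ, class of ψ) ↔ (μ, ε)`.
* `OccursInLineWeilCM L e₀ dL hdL hdL0 μ hμ ε v ψθ` — «`ψθ` OCCURS in `ω¹`»: the `ψθ ∘ det`-weight space of `ω¹` (★
  `Literature.RepresentationTheory.weightSpace`, the currency of ★ `rankOne_theta_dichotomy`) is non-zero.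
* `xThetaGqsCM L e₁ dV hdV hdV0 μ hμ χf ε v T ha h` — `X_v(μ, ε, χ_f)` (★ `xThetaCM`) READ ON the quasi-split avatar `U(Φ₃)(L⁺_v)`
  (★ `Gqs L v`) along a form congruence `ᵗT̄ · (diag dV)_v · T = a · Φ₃` (★ `cmDatumLocalCongr`, ★ `localPiEquiv`) — the group that
  carries the tree's Borel triple ★ `cmBorelTriple L 3 v`, so that «the Jacquet module of `X_v`» has a name.
NOT here: any assertion ([GR90 Prop. 5.2.2], the Jacquet-module letter, the Harish-Chandra criterion and the label pinning are the
sibling STATEMENT files of topic T7); the ε-sign of the occurring class [HarrisKudlaSweet1996 Thm. 6.1].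

## References
* [GelbartRogawski1991] S. Gelbart, J. Rogawski, *L-functions and Fourier–Jacobi coefficients for the unitary group U(3)*, Invent.
  Math. 105 (1991) 445–472: §3.2 (3.2.1)–(3.2.3) p. 457; Lemma 5.1.2 + Remark p. 466; proof of Prop. 5.2.1 p. 467 L25–27 (GDZ page images
  `pub-hodgecm-cf-rogawski-g6/lit/GR91-invent105/img_p466.jpg`, `img_p467.jpg`, read 2026-08-31).
* [GelbartRogawski1990] S. Gelbart, J. Rogawski, *Exceptional representations and Shimura's integral for the local unitary group
  U(3)*, Israel Math. Conf. Proc. 2 (1990) 19–75: Prop. 2.5.1 (b), Prop. 5.2.2 — cited THROUGH [GelbartRogawski1991 p. 467] and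
  [Haan2015 = arXiv:1501.00885, Thm. 3.4 and its proof, key [Ge2]]; NOT held (acq-10743).
* [Kudla1986] S. Kudla, *On the local theta-correspondence*, Invent. Math. 83 (1986), Thm. 2.8.
* [MoeglinVignerasWaldspurger1987] LNM 1291, Chap. 3 §IV.4 (the `(U(1), U(1))` dichotomy; ★ `rankOne_theta_dichotomy`).
* [Liu2021] Y. Liu, Camb. J. Math. 9 (2021) = arXiv:2102.11518: Def. 4.11, App. D §D.1 Steps 1–3 (l. 5217–5221).
* [Jacobowitz1962] R. Jacobowitz, *Hermitian forms over local fields*, Amer. J. Math. 84 (1962), Thm. 3.1.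
* [Rogawski1990] J. Rogawski, Ann. of Math. Stud. 123 (1990): §1.10 p. 9 (`M = {d(α, β, ᾱ⁻¹)}`), §12.2 (2) p. 174.
-/

set_option autoImplicit false

noncomputable section

open NumberField IsDedekindDomain MeasureTheory
open scoped Matrix Kronecker

namespace Literature.NumberTheory.GelbartRogawski1991

open Literature.NumberTheory Literature.NumberTheory.Automorphic Literature.NumberTheory.Automorphic.UnitaryGroup
open Literature.NumberTheory.Automorphic.IdeleClassGroup
open Literature.NumberTheory.Automorphic.Liu2021 Literature.NumberTheory.Automorphic.Liu2021.Def411WeilCarriers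
open Literature.NumberTheory.Automorphic.Liu2021.Def411WeilCarriersDoubling
open Literature.NumberTheory.GelbartRogawski1991.UnitaryDualPair Literature.NumberTheory.GelbartRogawski1991.UnitaryDualPair.WeilCoinv
open Literature.NumberTheory.GelbartRogawski1991.GRConstruction
open Literature.RepresentationTheory Literature.RepresentationTheory.Liu2021 Literature.RepresentationTheory.HarrisKudlaSweet1996
open Literature.NumberTheory.GaloisRepresentations
open Literature.NumberTheory.Rogawski1990

/-! ## §1 The `U(1)`-character `ψθ` of the theta datum and the Witt kernel line -/

set_option synthInstance.maxHeartbeats 400000 in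
set_option maxHeartbeats 8000000 in
/-- **`IsThetaCenterChar L μ χf ε v ψθ` — «`ψθ` is the `U(1)`-character of the local theta datum read on `E¹_v`»**: for every `u` in the
local unitary group `U((ε))(L⁺_v)` of the line (★ `localPi … 1 (JW ε) v`, = `E¹_v` through ★ `localDet`), `ψθ (det u) = χ_{f,v}(u) · μ_v(det u)⁻¹`
(★ `localCharOfCenter`, ★ `HeckeCharacter.semilocalComponent` of `toHeckeCharacter μ`).  GR's «`χ_v(γ_v¹)⁻¹`» [p. 467 L26] with `χ_v ↔ χ_{f,v}`
(the central character of `ω³(γ, ψ, χ)`) and `γ_v¹ = γ_v|_{E¹} ↔ μ_v|_{E¹_v}`.  TOKEN-IDENTICAL to the body of the Summits-side `CenterCharSpec`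
(`Cruxes/H413/Lines/F0_P2GR91NJacquet.lean` :63); a Prop constraining the binder `ψθ`, no data posited.
[cite: GelbartRogawski1991, §5.1 (5.1.1) p. 465; proof of Prop. 5.2.1 p. 467 L25–27] [cite: Rogawski1990, §12.2 (2) p. 174] -/
def IsThetaCenterChar (L : Type) [Field L] [NumberField L] [IsCMField L]
    (μ : Literature.NumberTheory.Automorphic.IdeleClassGroup L →ₜ* Circle)
    (χf : UnitaryGroup.finAdelicOne (↥(maximalRealSubfield L)) L (IsCMField.complexConj L) →* ℂˣ) (ε : (↥(maximalRealSubfield L))ˣ)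
    (v : HeightOneSpectrum (𝓞 ↥(maximalRealSubfield L))) (ψθ : ↥(normOneUnits (conjLocal L (IsCMField.complexConj L) v)) →* ℂˣ) : Prop :=
  ∀ u : ↥(localPi L (IsCMField.complexConj L) 1 (JW (↥(maximalRealSubfield L)) L ε) v),
    ψθ (localDet (IsCMField.complexConj L) v (isUnit_iff_ne_zero.mpr (by rw [Matrix.det_fin_one]; exact JW_apply_ne_zero (↥(maximalRealSubfield L)) L ε)) (localPiEquiv L (IsCMField.complexConj L) 1 (JW (↥(maximalRealSubfield L)) L ε) v u)) =
      localCharOfCenter (↥(maximalRealSubfield L)) L (IsCMField.complexConj L) (JW (↥(maximalRealSubfield L)) L ε) (JW_apply_ne_zero (↥(maximalRealSubfield L)) L ε) χf v u *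
        ((toHeckeCharacter L μ).semilocalComponent L v
          ((localDet (IsCMField.complexConj L) v (isUnit_iff_ne_zero.mpr (by rw [Matrix.det_fin_one]; exact JW_apply_ne_zero (↥(maximalRealSubfield L)) L ε)) (localPiEquiv L (IsCMField.complexConj L) 1 (JW (↥(maximalRealSubfield L)) L ε) v u) : ↥(normOneUnits (conjLocal L (IsCMField.complexConj L) v))) :
            (UnitaryGroup.LocalRing L v)ˣ))⁻¹

/-- **`kernelLineCM dV` — the Witt kernel line `L₀ = ⟨−d₁d₂d₃⟩` of `V = diag(d₁, d₂, d₃)`** (data): at every place `v` of `L⁺` non-split in `L`, a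
rank-3 hermitian space over `L_w/L⁺_v` is `H ⊕ L₀` with `disc L₀ ≡ −disc V` modulo norms (a hyperbolic plane has discriminant `−1`), so the
anisotropic factor of the Levi `M = E_vˣ × U(L₀)` of `U(V)(L⁺_v)` is `U(L₀)(L⁺_v) = E¹_v` for the GLOBAL line `⟨−d₁d₂d₃⟩` — the `U(1)` of GR's
`ω¹(γ, ψ)` inside the Jacquet module of `ω³(γ, ψ)` [GR91 §3.2 (3.2.1): `U₁ = {diag(1, u, 1)}`]. [cite: Jacobowitz1962, Thm. 3.1]
[cite: GelbartRogawski1991, §3.2 (3.2.1) p. 457] -/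
def kernelLineCM {L : Type} [Field L] (dV : Fin 3 → L) : Fin 1 → L :=
  fun _ => -(dV 0 * dV 1 * dV 2)

/-- The kernel line is `c̄`-fixed (its entry is a product of `c̄`-fixed entries). [cite: Jacobowitz1962, Thm. 3.1] -/
theorem complexConj_kernelLineCM {L : Type} [Field L] [NumberField L] [IsCMField L] (dV : Fin 3 → L)
    (hdV : ∀ i, IsCMField.complexConj L (dV i) = dV i) (i : Fin 1) :
    IsCMField.complexConj L (kernelLineCM dV i) = kernelLineCM dV i := by
  simp only [kernelLineCM, map_neg, map_mul, hdV]

/-- The kernel line is non-degenerate (its entry is a product of non-zero entries). [cite: Jacobowitz1962, Thm. 3.1] -/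
theorem kernelLineCM_ne_zero {L : Type} [Field L] (dV : Fin 3 → L) (hdV0 : ∀ i, dV i ≠ 0) (i : Fin 1) :
    kernelLineCM dV i ≠ 0 :=
  neg_ne_zero.mpr (mul_ne_zero (mul_ne_zero (hdV0 0) (hdV0 1)) (hdV0 2))

/-! ## §2 The rank-(1,1) line package and `ω¹` -/

set_option synthInstance.maxHeartbeats 400000 in
set_option maxHeartbeats 8000000 in
/-- **`lineSplittingsCM L e₀ dL hdL hdL0 θ hθ ε` — the `θ`-attached CM LOCAL SPLITTINGS of the RANK-(1,1) pair at the lines `⟨dL⟩`, `⟨ε⟩`**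
(data abbreviation): the body of ★ `chiLocalSplittingsCM` with `(Fin 3, dV) ↦ (Fin 1, dL)` — Kudla's `θ`-normalised per-place package of the
doubled group `U(dL ⊗ (ε) ⊕ −)` (★ `cmFinLocalFamily`, Haar data ★ `borelPlaceMeasure`), undoubled place by place (★ `undoubledSplittings`),
read on the Gram data `(T_W ε, J_W ε)` (★ `congrW`).  Its `omegaLoc v` is the Weil representation of `U(dL·ε)(L⁺_v)` on `𝒮(L⁺_v)` — for
`L_w` a field, GR's oscillator representation `ω¹(γ_v, ψ_v)` of `U(1)` [p. 467 L8–11] with `(γ, ψ mod N) ↔ (θ, ε)`.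
[cite: GelbartRogawski1991, §3.1 Prop. 3.1.1 p. 455 L1–3; §5.2 p. 467 L8–11] [cite: Liu2021, App. D §D.1 Step 2 (l. 5219)] -/
abbrev lineSplittingsCM (L : Type) [Field L] [NumberField L] [IsCMField L] {n₀ : ℕ} (e₀ : Fin 1 × Fin 1 ≃ Fin n₀) (dL : Fin 1 → L)
    (hdL : ∀ i, IsCMField.complexConj L (dL i) = dL i) (hdL0 : ∀ i, dL i ≠ 0)
    (θ : HeckeCharacter L) (hθ : IsSplittingChar L 1 θ) (ε : (↥(maximalRealSubfield L))ˣ) :=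
  congrW L e₀ dL hdL (lineW L (TW (↥(maximalRealSubfield L)) ε)) (complexConj_lineW L (TW (↥(maximalRealSubfield L)) ε))
    (realDiagonal_lineW L (TW (↥(maximalRealSubfield L)) ε))
    (diagonal_lineW L (TW (↥(maximalRealSubfield L)) ε) (JW_eq (↥(maximalRealSubfield L)) L ε))
    (undoubledSplittings L e₀ dL hdL hdL0 (lineW L (TW (↥(maximalRealSubfield L)) ε)) (complexConj_lineW L (TW (↥(maximalRealSubfield L)) ε))
      (lineW_ne_zero L (TW (↥(maximalRealSubfield L)) ε) (isUnit_det_TW (↥(maximalRealSubfield L)) ε)) θ (borelPlaceMeasure L)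
      (cmFinLocalFamily L e₀ dL hdL hdL0 (lineW L (TW (↥(maximalRealSubfield L)) ε)) (complexConj_lineW L (TW (↥(maximalRealSubfield L)) ε))
        (lineW_ne_zero L (TW (↥(maximalRealSubfield L)) ε) (isUnit_det_TW (↥(maximalRealSubfield L)) ε)) θ
        hθ (borelPlaceMeasure L)))
    (isSymm_TW (↥(maximalRealSubfield L)) ε) (JW_eq (↥(maximalRealSubfield L)) L ε)

set_option synthInstance.maxHeartbeats 400000 in
set_option maxHeartbeats 8000000 in
/-- **`lineWeilCM L e₀ dL hdL hdL0 μ hμ ε v` — GR's `ω¹(γ_v, ψ_v)`: the rank-one Weil representation at `v` of the line package at the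
conjugate-symplectic `μ`, read on `U((ε))(L⁺_v) = E¹_v`** (data abbreviation): `(lineSplittingsCM … (toHeckeCharacter μ) _ ε).omegaLoc v`
composed with the `U((ε))`-member ★ `localCenter` of the pair (for lines the member is an isomorphism onto `U(dL·ε)(L⁺_v) = E¹_v`; the
`U(dL)`-member ★ `localLineInl` is the SAME map of 1 × 1 unitary matrices, so «occurs» below does not depend on the side).
[cite: GelbartRogawski1991, §5.2 p. 467 L8–11; Remark p. 466] [cite: Liu2021, App. D §D.1 Step 3 (l. 5221)] -/
abbrev lineWeilCM (L : Type) [Field L] [NumberField L] [IsCMField L] {n₀ : ℕ} (e₀ : Fin 1 × Fin 1 ≃ Fin n₀) (dL : Fin 1 → L)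
    (hdL : ∀ i, IsCMField.complexConj L (dL i) = dL i) (hdL0 : ∀ i, dL i ≠ 0)
    (μ : Literature.NumberTheory.Automorphic.IdeleClassGroup L →ₜ* Circle) (hμ : IsConjugateSymplectic L μ)
    (ε : (↥(maximalRealSubfield L))ˣ) (v : HeightOneSpectrum (𝓞 ↥(maximalRealSubfield L))) :=
  (show Representation ℂ (localPi L (IsCMField.complexConj L) n₀ (Matrix.reindex e₀ e₀ (Matrix.diagonal dL ⊗ₖ JW (↥(maximalRealSubfield L)) L ε)) v) _ from
    (lineSplittingsCM L e₀ dL hdL hdL0 (toHeckeCharacter L μ) ((isOscillatorChar_toHeckeCharacter_iff μ).mpr hμ) ε).omegaLoc v).comp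
    (localCenter L (IsCMField.complexConj L) n₀ (Matrix.reindex e₀ e₀ (Matrix.diagonal dL ⊗ₖ JW (↥(maximalRealSubfield L)) L ε))
      (JW (↥(maximalRealSubfield L)) L ε) (JW_apply_ne_zero (↥(maximalRealSubfield L)) L ε) v)

set_option synthInstance.maxHeartbeats 400000 in
set_option maxHeartbeats 8000000 in
/-- **`OccursInLineWeilCM L e₀ dL hdL hdL0 μ hμ ε v ψθ` — «the character `ψθ` of `E¹_v` OCCURS in `ω¹(γ_v, ψ_v)`»**: the weight space of
`lineWeilCM … μ hμ ε v` for the character `u ↦ ψθ(det u)` of `U((ε))(L⁺_v)` (★ `Literature.RepresentationTheory.weightSpace`, the currency of the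
★ `(U(1), U(1))` dichotomy `rankOne_theta_dichotomy`: `dim ω_{s₁}[ξ] + dim ω_{s₂}[ξθ] = 1`) is non-zero.  For the compact abelian `E¹_v`
acting smoothly this is «`ψθ` is a constituent ∕ quotient ∕ subrepresentation of `ω¹`» indifferently. [cite: GelbartRogawski1991, Remark p. 466;
proof of Prop. 5.2.1 p. 467 L25–27] [cite: MoeglinVignerasWaldspurger1987, Chap. 3 §IV.4] -/
def OccursInLineWeilCM (L : Type) [Field L] [NumberField L] [IsCMField L] {n₀ : ℕ} (e₀ : Fin 1 × Fin 1 ≃ Fin n₀) (dL : Fin 1 → L)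
    (hdL : ∀ i, IsCMField.complexConj L (dL i) = dL i) (hdL0 : ∀ i, dL i ≠ 0)
    (μ : Literature.NumberTheory.Automorphic.IdeleClassGroup L →ₜ* Circle) (hμ : IsConjugateSymplectic L μ)
    (ε : (↥(maximalRealSubfield L))ˣ) (v : HeightOneSpectrum (𝓞 ↥(maximalRealSubfield L)))
    (ψθ : ↥(normOneUnits (conjLocal L (IsCMField.complexConj L) v)) →* ℂˣ) : Prop :=
  weightSpace (lineWeilCM L e₀ dL hdL hdL0 μ hμ ε v) id
      (fun u => ((ψθ (localDet (IsCMField.complexConj L) v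
        (isUnit_iff_ne_zero.mpr (by rw [Matrix.det_fin_one]; exact JW_apply_ne_zero (↥(maximalRealSubfield L)) L ε))
        (localPiEquiv L (IsCMField.complexConj L) 1 (JW (↥(maximalRealSubfield L)) L ε) v u)) : ℂˣ) : ℂ)) ≠ ⊥

/-! ## §3 `X_v(μ, ε, χ_f)` read on the quasi-split avatar `U(Φ₃)(L⁺_v)` -/

set_option synthInstance.maxHeartbeats 400000 in
set_option maxHeartbeats 8000000 in
/-- **`xThetaGqsCM L e₁ dV hdV hdV0 μ hμ χf ε v T ha h` — Liu's local theta type `X_v(μ, ε, χ_f)` (★ `xThetaCM`, a representation of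
`U(diag dV)(L⁺_v)`) READ ON `U(Φ₃)(L⁺_v)` (★ `Gqs L v`)** along a form congruence `ᵗT̄ · (diag dV)_v · T = a · Φ₃` (★ `cmDatumLocalCongr`:
`u ↦ T u T⁻¹`, then ★ `localPiEquiv` to the matrix avatar) — the group carrying the tree's Borel triple ★ `cmBorelTriple L 3 v`, its torus
characters ★ `cmXiTorusChar` and principal series ★ `cmPrincipalSeries`; so that the Jacquet module `r_N(X_v)` of the sibling letters is
`Representation.jacquetModule (xThetaGqsCM …) (cmBorelTriple L 3 v)`.  Such congruences exist at every non-split `v`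
(★ `Rogawski1990.exists_formCongr_eq_smul_antidiag`); classes do not depend on the choice (inner up to the centre for `N = 3`).
[cite: GelbartRogawski1991, §3.2 p. 457] [cite: Rogawski1990, §1.10 p. 9; §14.2 p. 232] -/
abbrev xThetaGqsCM (L : Type) [Field L] [NumberField L] [IsCMField L] {n' : ℕ} (e₁ : Fin 3 × Fin 1 ≃ Fin n') (dV : Fin 3 → L)
    (hdV : ∀ i, IsCMField.complexConj L (dV i) = dV i) (hdV0 : ∀ i, dV i ≠ 0)
    (μ : Literature.NumberTheory.Automorphic.IdeleClassGroup L →ₜ* Circle) (hμ : IsConjugateSymplectic L μ)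
    (χf : UnitaryGroup.finAdelicOne (↥(maximalRealSubfield L)) L (IsCMField.complexConj L) →* ℂˣ) (ε : (↥(maximalRealSubfield L))ˣ)
    (v : HeightOneSpectrum (𝓞 ↥(maximalRealSubfield L)))
    (T : GL (Fin 3) (UnitaryGroup.LocalRing L v)) {a : UnitaryGroup.LocalRing L v} (ha : IsUnit a)
    (h : formCongr (conjLocal L (IsCMField.complexConj L) v) T ((Matrix.diagonal dV).map (algebraMap L (UnitaryGroup.LocalRing L v))) =
      a • (Matrix.of fun i j : Fin 3 => if i.val + j.val + 1 = 3 then (1 : L) else 0).map (algebraMap L (UnitaryGroup.LocalRing L v))) :=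
  (show Representation ℂ (localPi L (IsCMField.complexConj L) 3 (Matrix.diagonal dV) v) _ from xThetaCM L e₁ dV hdV hdV0 μ hμ χf ε v).comp
    ((localPiEquiv L (IsCMField.complexConj L) 3 (Matrix.diagonal dV) v).symm.toMulEquiv.toMonoidHom.comp
      (cmDatumLocalCongr L v T ha h : Gqs L v ≃ₜ* (cmDatum L 3 (Matrix.diagonal dV)).Local v).toMulEquiv.toMonoidHom)

end Literature.NumberTheory.GelbartRogawski1991

end
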